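import Summits.BirchSwinnertonDyer.BirchSwinnertonDyer.Theses.KolyvaginDepthDoor
import Summits.BirchSwinnertonDyer.BirchSwinnertonDyer.Theorems.KolyvaginDepthDoorKNSupplyLevelOneOfStructure
import Summits.BirchSwinnertonDyer.BirchSwinnertonDyer.Theorems.KolyvaginDepthDoorKNSupplyAnalyticRankLeOne
import Summits.BirchSwinnertonDyer.BirchSwinnertonDyer.Theorems.KolyvaginDepthDoorKNSupplyLargeAdmissiblePrimeSplit
import Summits.BirchSwinnertonDyer.BirchSwinnertonDyer.Theorems.KolyvaginDepthDoorKNSupplyManinFrameStructure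
import Literature.NumberTheory.EllipticCurves.LeadingTerm
import Literature.NumberTheory.EllipticCurves.BSDSha
import HarnessLib

/-!
# Route `KolyvaginDepthDoor`, crux `KolyvaginDepthSupplyKN` (stmt-BirchSwinnertonDyer-22820) —
# COMPOSITION OF LINE `levelone`, SKELETON v9: the crux from ONE OPEN STUB and PRINT FACTS BY NAME ONLY
# (no `p`-optimal frame, no bookkeeping input: Castella–Sano 2026 Thm. 3 with (manin) `p ∤ c_φ`,
# the frame from Mazur 1978 + Néron scaling)

Helper file of the lead prover (kdd-p1 g13; `--supports stmt-BirchSwinnertonDyer-22820 --as helper`);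
it closes nothing and BSD is not proved by it.

v8 (`KolyvaginDepthDoorKNSupplyCompositionV8`) reduced the crux to (1′) «`Ш(E)[p] = 0` eventually at
analytic rank `≥ 2` on non-CM curves» (OPEN) + eight print facts + ONE bookkeeping input, the
`p`-optimal parametrisation datum required by the Burungale–Castella–Grossi–Skinner record. v9 trades
BCGS 2026 Thm. 2 for Castella–Sano 2026 Thm. 3 (split case), whose frame hypothesis is (manin)
`p ∤ c_φ` — and a datum with `p ∤ c` EXISTS by
`Summit.BirchSwinnertonDyer.Rank1Residual.X11b.exists_modularParametrizationData_not_dvd` modulo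
modularity, Mazur 1978 Cor. 4.1 (`mazur_not_dvd_maninConstant_of_odd`) and the Néron mapping property
(`integral_neronScaling_of_isGloballyMinimal`), all PRINT BY NAME. Hence the composition's inputs are
exactly: (1′) (OPEN — the only open mathematics); PRINT by name: modularity, Hoffstein–Luo,
Bump–Friedberg–Hoffstein, GZK, Gross–Zagier I.6.3, Castella–Sano Thm. 3, Zanarella Prop. 2.18 (Selmer
form), Howard–Zanarella rigidity, Mazur 1978 Cor. 4.1, Néron scaling. NO bookkeeping stub.

* `kolyvaginDepthSupplyKN_of_hypotheses_manin` — the v9 composition (crux BY NAME).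
* `kolyvaginDepthSupplyKN_of_shaFiniteConjecture_manin` — the class-wide calibration, v9: Tate's
  `ShaFiniteConjecture` + ten print facts ⟹ crux.

CONDITIONAL on its hypotheses; nothing class-wide is discharged; BSD is NOT proved by this.

References: [Tate1974] Conj. 1; [CastellaSano2026] Thm. 3; [Zanarella2019] Prop. 2.18, Cor. 2.12,
2.14, Prop. 2.15; [Howard2004] Thm. 1.4.2, Prop. 1.5.5, Lemma 1.6.4; [Mazur1978] Cor. 4.1;
[GrossZagier1986] Thm. I.6.3; [BumpFriedbergHoffstein1990]; [HoffsteinLuo1997]; [Darmon2004] Thm. 3.22;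
[Serre1972] §4.2; [SilvermanAEC2009] X.4.2; [WZhang2014] Lemma 8.4 (1) (shape only).
-/

set_option linter.dupNamespace false

noncomputable section

open scoped Classical NumberField

namespace Summit.BirchSwinnertonDyer.BirchSwinnertonDyer.Theorems.KolyvaginDepthDoor

open Literature.NumberTheory.EllipticCurves Literature.NumberTheory.EllipticCurves.ModularForms
  WeierstrassCurve IsDedekindDomain
open Summit.BirchSwinnertonDyer.BirchSwinnertonDyer.Theorems
open Summit.BirchSwinnertonDyer.BirchSwinnertonDyer.Theses.KolyvaginDepthDoor

/-- A finite subgroup `H ≤ G` with `#H < p`, `p` prime, meets `G[p]` trivially (private restatement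
of `KolyvaginDepthDoorKNSupplyCalibration.inf_torsionBy_eq_bot_of_natCard_lt`, keeping this file out of
that file's import cone). [folklore] -/
private theorem inf_torsionBy_eq_bot_of_natCard_lt_aux₉ {G : Type*} [AddCommGroup G]
    (H : AddSubgroup G) [Finite H] {p : ℕ} (hp : p.Prime) (hlt : Nat.card H < p) :
    (H ⊓ AddSubgroup.torsionBy G (p : ℤ) : AddSubgroup G) = ⊥ := by
  rw [eq_bot_iff]
  intro x hx
  obtain ⟨hxH, hxT⟩ := AddSubgroup.mem_inf.mp hx
  rw [AddSubgroup.mem_bot]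
  have hpx : p • x = 0 := AddSubgroup.torsionBy.nsmul_iff.mp hxT
  set y : H := ⟨x, hxH⟩ with hy
  have hpy : p • y = 0 := Subtype.ext (by simp [hy, hpx])
  have hdvd : addOrderOf y ∣ p := addOrderOf_dvd_of_nsmul_eq_zero hpy
  rcases (Nat.dvd_prime hp).mp hdvd with h1 | hP
  · have : y = 0 := AddMonoid.addOrderOf_eq_one_iff.mp h1
    simpa [hy] using congrArg Subtype.val this
  · exfalso
    have hcard : addOrderOf y ∣ Nat.card H := addOrderOf_dvd_natCard y
    rw [hP] at hcard
    have := Nat.le_of_dvd Nat.card_pos hcard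
    omega

/-- **The composition of line `levelone`, SKELETON v9 (sorry-free): `KolyvaginDepthSupplyKN` BY NAME
from** (1′) «`Ш(E)[p] = 0` for all large `p`» on non-CM curves of analytic rank `≥ 2` (OPEN), the
print facts `exists_isNewformOf ∧ HoffsteinLuo1997 ∧ BFH1990 ∧ GZK` and Gross–Zagier I.6.3 (the twist
supply and the analytic-rank-`≤ 1` slice), the three print facts of the Kodaira–Néron cell — Castella–Sano
2026 Thm. 3 (split case, (manin) `p ∤ c_φ`), Zanarella 2019 Prop. 2.18 (Selmer-module form), Howard
2004 / Zanarella 2019 mod-`p` rigidity —, and the two print facts that supply a frame with `p ∤ c`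
(Mazur 1978 Cor. 4.1, Néron scaling: `hFrame`). NO W. Zhang fact, NO ♠ split, NO bookkeeping input.
Analytic rank `≤ 1`: `kolyvaginDepthSupplyKN_body_of_analyticRank_le_one`. Analytic rank `≥ 2`: `K`
first (`stub_heegner_field_supply_of_facts`), GZK on the twist, `p` large admissible Kodaira–Néron
split in `K` (`exists_large_admissiblePrime_kodairaNeron_split_of_not_hasCM`), `Ш(E)[p] = 0` (1′),
`Ш(E^{(d_K)})[p] = 0` (finite of order `< p`), the print structure statement
`exists_kolyvaginClass_one_selmerCard_of_maninPrint`, and the route-free conversion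
`levelOne_kolyvaginClass_rankClause_of_structure`. `#print axioms` standard. CONDITIONAL; BSD is not
proved by it. [cite: CastellaSano2026, Thm. 3 (arXiv:2601.14504 §1.1.6)] [cite: Zanarella2019, Prop. 2.18, Cor. 2.14]
[cite: Howard2004, Lemma 1.6.4] [cite: Mazur1978, Cor. 4.1] [cite: GrossZagier1986, Thm. I.6.3 with V.§2] [cite: Darmon2004, Thm. 3.22]
[cite: WZhang2014, Lemma 8.4 (1) (p. 236)] -/
theorem kolyvaginDepthSupplyKN_of_hypotheses_manin
    (hSha : ∀ (W : WeierstrassCurve ℚ) [W.IsElliptic] [W.IsGloballyMinimal], ¬ W.HasCM →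
      2 ≤ W.analyticRank →
      ∃ B : ℕ, ∀ (p : ℕ) [Fact p.Prime], B < p →
        (W.sha ⊓ AddSubgroup.torsionBy W.galH1 (p : ℤ) : AddSubgroup W.galH1) = ⊥)
    (hPrint : exists_isNewformOf ∧ HoffsteinLuo1997_exists_twist_L_one_ne_zero ∧
      bumpFriedbergHoffstein_exists_heegnerField_split_twist_simpleZero ∧
      rank_eq_analyticRank_of_analyticRank_le_one)
    (hGZ : ∀ (W : WeierstrassCurve ℚ) (N : ℕ) [NeZero N] (K : Type) [Field K] [NumberField K],
      analyticRankEK_eq_one_iff_heegner_nonTorsion W N K)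
    (hRes : Literature.NumberTheory.EllipticCurves.CastellaSano2026_kolyvaginClass_selmerDivisibility_eq_padicValNat_tamagawaProduct ∧
      Literature.NumberTheory.EllipticCurves.Zanarella2019_kolyvaginClass_one_ne_zero_of_not_selmerDivisible ∧
      Literature.NumberTheory.EllipticCurves.HowardZanarella_exists_minimal_kolyvaginClass_one_selmerCard_of_ne_zero)
    (hFrame : mazur_not_dvd_maninConstant_of_odd ∧ integral_neronScaling_of_isGloballyMinimal) :
    KolyvaginDepthSupplyKN := by
  intro W _ _ hcm
  -- RANK SPLIT: analytic rank `≤ 1` is print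
  by_cases hr : W.analyticRank ≤ 1
  · exact kolyvaginDepthSupplyKN_body_of_analyticRank_le_one hPrint hGZ W hcm hr
  obtain ⟨hmod, hHL, hBFH, hGZK⟩ := hPrint
  obtain ⟨h2, hZ, hHZ⟩ := hRes
  have h2an : 2 ≤ W.analyticRank := by omega
  have hP := exists_large_admissiblePrime_kodairaNeron_of_not_hasCM W hcm
  haveI iNZ : NeZero (W.conductorNorm ℤ) := ⟨(W.conductorNorm_pos_holds).ne'⟩
  -- an auxiliary admissible prime, only to call the HK theorem (its `p`-hypotheses are idle)
  obtain ⟨p₁, hp₁, -, h5₁, hgood₁, hord₁, hsurj₁, -⟩ := hP 0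
  haveI := hp₁
  -- `K` FIRST: Heegner, `d_K` odd, `≠ −3, −4`, `ord L(E^{(d_K)}) ≤ 1`
  obtain ⟨K, iF, iN, hK, hD3, hD4, -, hH, hodd, -, hle, -⟩ :=
    stub_heegner_field_supply_of_facts hmod hHL hBFH W p₁ h5₁ hgood₁ hord₁ hsurj₁
  -- GZK on the twist: rank `≤ 1`, `Ш` finite
  have hdK0 : (NumberField.discr K : ℚ) ≠ 0 := by exact_mod_cast NumberField.discr_ne_zero K
  haveI iT := W.isElliptic_quadraticTwist hdK0
  obtain ⟨hrT, hfinT⟩ := hGZK (W.quadraticTwist (NumberField.discr K : ℚ)) hle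
  have hT1 : (W.quadraticTwist (NumberField.discr K : ℚ)).mordellWeilRank ≤ 1 := by
    rw [hrT]; exact hle
  haveI := hfinT
  -- THEN `p` large, admissible Kodaira–Néron and SPLIT in `K`
  obtain ⟨B₁, hB₁⟩ := hSha W hcm h2an
  obtain ⟨p, hp, hBp, h5, hgood, hord, hsurj, htower, -, hKN, hspl, -⟩ :=
    exists_large_admissiblePrime_kodairaNeron_split_of_not_hasCM W hcm K hK
      (max B₁ (max (NumberField.discr K).natAbs
        (Nat.card ↥(W.quadraticTwist (NumberField.discr K : ℚ)).sha)))
  haveI := hp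
  have hpP : p.Prime := hp.out
  have hB₁p : B₁ < p := lt_of_le_of_lt (le_max_left _ _) hBp
  have hdKp : (NumberField.discr K).natAbs < p :=
    lt_of_le_of_lt ((le_max_left _ _).trans (le_max_right _ _)) hBp
  have hShaTp : Nat.card ↥(W.quadraticTwist (NumberField.discr K : ℚ)).sha < p :=
    lt_of_le_of_lt ((le_max_right _ _).trans (le_max_right _ _)) hBp
  -- `p ∤ d_K`
  have hpD : ¬ ((p : ℤ) ∣ NumberField.discr K) := by
    intro h
    have h1 : p ∣ (NumberField.discr K).natAbs := by
      have := Int.natAbs_dvd_natAbs.mpr h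
      simpa using this
    have h2 := Nat.le_of_dvd (Int.natAbs_pos.mpr (NumberField.discr_ne_zero K)) h1
    omega
  -- `(d_K, N) = 1` from the Heegner hypothesis
  have hDN : IsCoprime (NumberField.discr K) ((W.conductorNorm ℤ : ℕ) : ℤ) := by
    rw [Int.isCoprime_iff_gcd_eq_one, Int.gcd_comm]
    exact Literature.SatisfiesHeegnerHypothesis.coprime_discr hK.1 hH
  -- `Ш(E)[p] = 0` (the `Ш`-stub) and `Ш(E^{(d_K)})[p] = 0` (finite of order `< p`)
  have hshaW := hB₁ p hB₁p
  have hshaT := inf_torsionBy_eq_bot_of_natCard_lt_aux₉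
    (W.quadraticTwist (NumberField.discr K : ℚ)).sha hpP hShaTp
  -- the mod-`p` structure statement at `(E, p, K)`: PRINT BY NAME on the whole cell (no ♠ split,
  -- frame with `p ∤ c` from Mazur + Néron scaling)
  have hstr := exists_kolyvaginClass_one_selmerCard_of_maninPrint h2 hZ hHZ hmod hFrame.1 hFrame.2 W p
    h5 hgood hord hsurj htower hKN K hK hH hodd hD3 hD4 hDN hpD hspl
  -- the level-one class with the signed clause, and assembly
  obtain ⟨Dt, β, ι, n, d, hsupp, hne, hclause⟩ :=
    levelOne_kolyvaginClass_rankClause_of_structure W p hsurj K hstr hshaW hshaT hT1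
  exact ⟨p, hp, h5, hgood, hord, htower, hKN, K, iF, iN, hK, hD3, hD4, iNZ, hH, Dt, β, ι, n, d,
    hsupp.1, hsupp.2, hne, hclause⟩

/-- **CLASS-WIDE CALIBRATION, v9.** `KolyvaginDepthSupplyKN` follows from Tate's `ShaFiniteConjecture`
(OPEN, by name; used at analytic rank `≥ 2` only) and TEN PRINT FACTS BY NAME (modularity,
Hoffstein–Luo, BFH, GZK, Gross–Zagier I.6.3, Castella–Sano Thm. 3, Zanarella Prop. 2.18, Howard–Zanarella
rigidity, Mazur 1978 Cor. 4.1, Néron scaling) — nothing else. CONDITIONAL; nothing is discharged; BSD is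
not proved by it. [cite: Tate1974, Conj. 1] [cite: CastellaSano2026, Thm. 3] [cite: Zanarella2019, Prop. 2.18]
[cite: Howard2004, Lemma 1.6.4] [cite: Mazur1978, Cor. 4.1] [cite: GrossZagier1986, Thm. I.6.3] -/
theorem kolyvaginDepthSupplyKN_of_shaFiniteConjecture_manin (hfin : ShaFiniteConjecture)
    (hPrint : exists_isNewformOf ∧ HoffsteinLuo1997_exists_twist_L_one_ne_zero ∧
      bumpFriedbergHoffstein_exists_heegnerField_split_twist_simpleZero ∧
      rank_eq_analyticRank_of_analyticRank_le_one)
    (hGZ : ∀ (W : WeierstrassCurve ℚ) (N : ℕ) [NeZero N] (K : Type) [Field K] [NumberField K],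
      analyticRankEK_eq_one_iff_heegner_nonTorsion W N K)
    (hRes : Literature.NumberTheory.EllipticCurves.CastellaSano2026_kolyvaginClass_selmerDivisibility_eq_padicValNat_tamagawaProduct ∧
      Literature.NumberTheory.EllipticCurves.Zanarella2019_kolyvaginClass_one_ne_zero_of_not_selmerDivisible ∧
      Literature.NumberTheory.EllipticCurves.HowardZanarella_exists_minimal_kolyvaginClass_one_selmerCard_of_ne_zero)
    (hFrame : mazur_not_dvd_maninConstant_of_odd ∧ integral_neronScaling_of_isGloballyMinimal) :
    KolyvaginDepthSupplyKN :=
  kolyvaginDepthSupplyKN_of_hypotheses_manin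
    (fun W hE _ _ _ ↦ by
      haveI : Finite W.sha := hfin W hE
      exact ⟨Nat.card ↥W.sha, fun _p hp hB ↦ inf_torsionBy_eq_bot_of_natCard_lt_aux₉ W.sha hp.out hB⟩)
    hPrint hGZ hRes hFrame

end Summit.BirchSwinnertonDyer.BirchSwinnertonDyer.Theorems.KolyvaginDepthDoor

end
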